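import Summits.QuantumFields.QCD.Theorems.SpectralDefectExtinctionWindowExtinctionStubSectorCharpolyFourier
import HarnessLib

/-!
# Sector decomposition of `Γ₅ D_W` for the product-flux field — `charpoly (Γ₅ D_W) = ∏ₖ charpoly (sectorH k)`

Route SpectralDefectExtinction, crux `WindowExtinction`, line free-volume-heavy-witness (r6): **stub S13
`stub_sectorCharpoly`** (= the skeleton's `SectorCharpoly`), file 3 of 3.

For Lüscher's flux-sector field `V = V_[m]` at the two-plane tensor `(m₀₁, m₂₃) = (jL, j′L)` (so `V(x,0) = V(x,2) = 1`,
`V(x,1) = e^{2πijx₀/L}`, `V(x,3) = e^{2πij′x₂/L}`, translation-invariant in `x₁, x₃`) the Hermitian Wilson–Dirac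
operator `N = Γ₅ D_W(V, m₀, 1)` of the tree satisfies `N · E = E · ⊕_{k ∈ (ℤ/L)²} sectorH L j j′ k₁ k₃ m₀`
(`hermitianWilsonDirac_mul_blochE`) for the explicit intertwiner `E` of the sibling file (plane waves in `x₁, x₃`
times the `CNOT` relabelling of the chiral spinor into the sector labels), `E` is invertible (`E (L⁻²G) = 1`,
`(L⁻²G) E = 1`), hence `charpoly N = charpoly (⊕ₖ sectorH k) = ∏ₖ charpoly (sectorH k)`.  Everything is proved; pure
finite-dimensional algebra (no analytic input).  Validated numerically beforehand (`L = 3`, three parameter sets, to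
`10⁻¹⁴`).
-/

noncomputable section

namespace Summit.QuantumFields.QCD.Cruxes.WindowExtinction.FreeVolumeHeavyWitness

open Matrix Complex Finset
open scoped Kronecker
open Literature.MathematicalPhysics.QuantumLattice Literature.MathematicalPhysics.QuantumFieldTheory
  Literature.Probability.LatticeModels

/-! ### Generic linear algebra -/

/-- `charpoly (blockDiagonal M) = ∏ₖ charpoly (M k)` (the characteristic matrix of a block-diagonal matrix is
block-diagonal; Mathlib `Matrix.det_blockDiagonal`). -/
theorem sectorCharpoly_blockDiagonal {m o R : Type*} [Fintype m] [DecidableEq m] [Fintype o] [DecidableEq o]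
    [CommRing R] (M : o → Matrix m m R) :
    (Matrix.blockDiagonal M).charpoly = ∏ k, (M k).charpoly := by
  unfold Matrix.charpoly
  rw [← Matrix.det_blockDiagonal]
  congr 1
  ext ⟨i, k⟩ ⟨i', k'⟩
  simp only [Matrix.charmatrix_apply, Matrix.blockDiagonal_apply, Matrix.diagonal_apply, Prod.mk.injEq]
  by_cases hk : k = k' <;> by_cases hi : i = i' <;> simp [hk, hi]

/-- If `N E = E B` with `E` invertible (`E G = 1`, `G E = 1`) between index types of the same cardinality, then
`charpoly N = charpoly B` (`charpoly (E (B G)) · X^{#C} = charpoly ((B G) E) · X^{#I}`, Mathlib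
`Matrix.charpoly_mul_comm'`). -/
theorem sectorCharpoly_of_intertwine {I C : Type*} [Fintype I] [DecidableEq I] [Fintype C] [DecidableEq C]
    {N : Matrix I I ℂ} {B : Matrix C C ℂ} (E : Matrix I C ℂ) (G : Matrix C I ℂ)
    (hEG : E * G = 1) (hGE : G * E = 1) (hNE : N * E = E * B) (hcard : Fintype.card I = Fintype.card C) :
    N.charpoly = B.charpoly := by
  have h1 : N = E * (B * G) := by
    rw [← Matrix.mul_assoc, ← hNE, Matrix.mul_assoc, hEG, Matrix.mul_one]
  have h2 := Matrix.charpoly_mul_comm' E (B * G)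
  rw [← h1, Matrix.mul_assoc, hGE, Matrix.mul_one, hcard] at h2
  exact (Polynomial.isRegular_X_pow _).left h2

variable {L : ℕ} [NeZero L] (j j' : ℤ)

/-! ### `E` is invertible -/

/-- The two index types have the same cardinality `4L⁴`. -/
theorem card_fermionIdx_eq_card_sectorIdx :
    Fintype.card (TorusSite 4 L × Fin 1 × Fin 4) = Fintype.card (SectorIdx L × (ZMod L × ZMod L)) := by
  simp only [Fintype.card_prod, Fintype.card_sum, Fintype.card_fun, ZMod.card, Fintype.card_fin]
  ring

/-- `E (L⁻² G) = 1`. -/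
theorem blochE_mul_blochG_smul :
    blochE L * (((L : ℂ) ^ 2)⁻¹ • blochG L) = 1 := by
  have hL : ((L : ℂ) ^ 2) ≠ 0 := pow_ne_zero _ (Nat.cast_ne_zero.mpr (NeZero.ne L))
  rw [Matrix.mul_smul, blochE_mul_blochG, smul_smul, inv_mul_cancel₀ hL, one_smul]

/-- `(L⁻² G) E = 1`: `E` is invertible (a one-sided inverse of a square matrix is two-sided). -/
theorem blochG_smul_mul_blochE :
    (((L : ℂ) ^ 2)⁻¹ • blochG L) * blochE L = 1 :=
  (Matrix.mul_eq_one_comm_of_card_eq _ _ _ card_fermionIdx_eq_card_sectorIdx).mp blochE_mul_blochG_smul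

/-! ### `Γ₅ D_W · E = E · ⊕ₖ sectorH k` -/

/-- Entry `((x, a, α), (ι, k))` of `E · ⊕_{k'} sectorH(k')`: the plane wave `χ_k(x)` times the `sectorH(k)` entry between
the sector label of `(α, x₂, x₀)` and `ι`. -/
theorem blochE_mul_blockDiagonal_apply (m₀ : ℝ) (x : TorusSite 4 L) (a : Fin 1) (α : Fin 4)
    (c : SectorIdx L × (ZMod L × ZMod L)) :
    (blochE L * Matrix.blockDiagonal fun k : ZMod L × ZMod L => sectorH L j j' k.1 k.2 m₀) (x, a, α) c =
      blochPhase L c.2 x * sectorH L j j' c.2.1 c.2.2 m₀ (toSectorIdx α (x 2) (x 0)) c.1 := by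
  obtain ⟨ι, k⟩ := c
  rw [Matrix.mul_apply, Fintype.sum_prod_type, Finset.sum_eq_single (toSectorIdx α (x 2) (x 0))]
  · rw [Finset.sum_eq_single k]
    · simp [blochE, siteE, Matrix.blockDiagonal_apply]
    · intro k' _ hk'
      simp [Matrix.blockDiagonal_apply, hk']
    · intro h
      exact absurd (Finset.mem_univ _) h
  · intro ι' _ hι'
    apply Finset.sum_eq_zero
    intro k' _
    have hne : ¬(α = sectorSpin ι' ∧ x 0 = sectorPosB ι' ∧ x 2 = sectorPosA ι') := by
      rintro ⟨h1, h2, h3⟩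
      apply hι'
      rw [← toSectorIdx_sectorSpin ι', ← h1, ← h2, ← h3]
    simp only [blochE, siteE, Matrix.of_apply]
    by_cases h1 : α = sectorSpin ι' <;> by_cases h2 : x 0 = sectorPosB ι' <;>
      by_cases h3 : x 2 = sectorPosA ι' <;> simp_all
  · intro h
    exact absurd (Finset.mem_univ _) h

/-- **The intertwining identity** `Γ₅ D_W(V_[(jL, j′L)], m₀, 1) · E = E · ⊕ₖ sectorH L j j′ k₁ k₃ m₀`. -/
theorem hermitianWilsonDirac_mul_blochE (m₀ : ℝ) :
    (spinorLift gammaFive * wilsonDirac u1Rep (fluxSectorField L (prodFluxTensor L j j')) m₀ 1 * blochE L :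
        Matrix (TorusSite 4 L × Fin 1 × Fin 4) (SectorIdx L × (ZMod L × ZMod L)) ℂ) =
      blochE L * Matrix.blockDiagonal fun k : ZMod L × ZMod L => sectorH L j j' k.1 k.2 m₀ := by
  ext ⟨x, a, α⟩ c
  rw [hermitianWilsonDirac_mul_blochE_apply, blochE_mul_blockDiagonal_apply, hopBlockEntry_eq_sectorH]

/-! ### The stub -/

/-- **S13 · exact sector decomposition (`SectorCharpoly`).**  For every `L ≥ 1`, `j, j′ ∈ ℤ` and every mass `m₀`,
the characteristic polynomial of the Hermitian Wilson–Dirac operator `Γ₅ D_W(V_[m], m₀, 1)` of Lüscher's flux-sector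
field at the tensor `(m₀₁, m₂₃) = (jL, j′L)` is the product over the `L²` characters `(k₁, k₃) ∈ (ℤ/L)²` of the
characteristic polynomials of the sector operators `sectorH L j j′ k₁ k₃ m₀` (partial Fourier transform in `x₁, x₃`
and the constant spin relabelling `CNOT` of the chiral basis; `hermitianWilsonDirac_mul_blochE`). -/
theorem stub_sectorCharpoly : ∀ (L : ℕ) [NeZero L] (j j' : ℤ) (m₀ : ℝ), (spinorLift gammaFive * wilsonDirac u1Rep (fluxSectorField L (fun μ ν : Fin 4 => if μ = 0 ∧ ν = 1 then j * L else if μ = 1 ∧ ν = 0 then -(j * L) else if μ = 2 ∧ ν = 3 then j' * L else if μ = 3 ∧ ν = 2 then -(j' * L) else 0)) m₀ 1).charpoly = ∏ k : ZMod L × ZMod L, (sectorH L j j' k.1 k.2 m₀).charpoly := by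
  intro L _ j j' m₀
  show (spinorLift gammaFive * wilsonDirac u1Rep (fluxSectorField L (prodFluxTensor L j j')) m₀ 1).charpoly = _
  rw [← sectorCharpoly_blockDiagonal]
  exact sectorCharpoly_of_intertwine (blochE L) (((L : ℂ) ^ 2)⁻¹ • blochG L) blochE_mul_blochG_smul
    blochG_smul_mul_blochE (hermitianWilsonDirac_mul_blochE j j' m₀) card_fermionIdx_eq_card_sectorIdx

end Summit.QuantumFields.QCD.Cruxes.WindowExtinction.FreeVolumeHeavyWitness

end
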